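import Mathlib.LinearAlgebra.Matrix.GeneralLinearGroup.Card
import Mathlib.Algebra.Field.ZMod
import HarnessLib

/-!
# Route SzkEntropy, crux `PeaThreeNotInP` (stmt-PneNP-10776), line `SketchIdeator3`: stub `stub_density`

At least a quarter of all `n × n` matrices over `F₂` are invertible:

  `4 · |GL_n(F₂)| ≥ 2^{n²}`.

Mathlib's `Matrix.card_GL_field` gives `|GL_n(F_q)| = ∏_{i<n} (qⁿ - qⁱ)`; the estimate
`4 · ∏_{i<n} (2ⁿ - 2ⁱ) ≥ 2^{n²}` is the elementary bound `∏_{j=1}^{n} (1 - 2^{-j}) ≥ ¼ + 2^{-(n+1)}`,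
proved here entirely in `ℕ` in the multiplied-out form
`2^{m+2} · ∏_{i<m+1} (2^{m+1} - 2ⁱ) ≥ 2^{(m+1)²} · (2^m + 1)` by induction on `m`
(`prod_two_pow_sub_succ` is the recurrence `Q(n+1) = (2^{n+1} - 1) · 2ⁿ · Q(n)` of the product,
`step_arith` the arithmetic of the induction step).

In the skeleton of the line this feeds `card_triple_le` (`|Triple a b c| ≤ 64 · #invertible triples`).
The statement mentions no object of the line; the namespace is bookkeeping only.

References: folklore.
-/

noncomputable section

open Finset Matrix

namespace Summit.PneNP.PneNP.Cruxes.PeaThreeNotInP.TensorIsoLine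

set_option linter.dupNamespace false -- `Summit.PneNP.PneNP.…`: summit = sub-problem name (D-0017 single-conjunct layout)

/-- Recurrence of `Q(n) = ∏_{i<n} (2ⁿ - 2ⁱ)`:
`Q(n+1) = (2^{n+1} - 1) · (2ⁿ · Q(n))` (split off the factor `i = 0` and pull a `2` out of each of
the remaining `n` factors, `2^{n+1} - 2^{i+1} = 2 · (2ⁿ - 2ⁱ)`). [folklore] -/
theorem prod_two_pow_sub_succ (n : ℕ) :
    ∏ i : Fin (n + 1), (2 ^ (n + 1) - 2 ^ (i : ℕ)) =
      (2 ^ (n + 1) - 1) * (2 ^ n * ∏ i : Fin n, (2 ^ n - 2 ^ (i : ℕ))) := by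
  have h : ∀ i : ℕ, 2 ^ (n + 1) - 2 ^ (i + 1) = 2 * (2 ^ n - 2 ^ i) := by
    intro i
    rw [pow_succ, pow_succ]
    omega
  rw [Fin.prod_univ_succ]
  simp only [Fin.val_zero, pow_zero, Fin.val_succ, h]
  rw [prod_mul_distrib, prod_const, card_univ, Fintype.card_fin]

/-- Arithmetic core of the induction step of `key_bound`: with `x = 2^m`, `y = 2^{m+2} - 1`,
`P = 2^{(m+1)²}`, `q = Q(m+1)`, the hypothesis `P (x+1) ≤ 4 x q` gives
`8 x² P (2x+1) ≤ 8x · y · 2x · q` (because `(4x-1)(x+1) ≥ 2x(2x+1)` for `x ≥ 1`). [folklore] -/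
theorem step_arith {P x q y : ℕ} (hx : 1 ≤ x) (hy : y + 1 = 4 * x)
    (ih : P * (x + 1) ≤ 4 * x * q) :
    P * (8 * (x * x)) * (2 * x + 1) ≤ 8 * x * (y * (2 * x * q)) := by
  have h1 : P * (x + 1) * (4 * x * y) ≤ 4 * x * q * (4 * x * y) := Nat.mul_le_mul_right _ ih
  have h3 : (y + 1) * (P * (x * x)) = 4 * x * (P * (x * x)) := by rw [hy]
  have h4 : (y + 1) * (P * x) = 4 * x * (P * x) := by rw [hy]
  have h5 : 1 * (P * x) ≤ x * (P * x) := Nat.mul_le_mul_right _ hx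
  nlinarith [h1, h3, h4, h5]

/-- The density estimate in multiplied-out form:
`2^{(m+1)²} · (2^m + 1) ≤ 2^{m+2} · ∏_{i<m+1} (2^{m+1} - 2ⁱ)`, i.e.
`∏_{j=1}^{m+1} (1 - 2^{-j}) ≥ ¼ + 2^{-(m+2)}`, by induction on `m`. [folklore] -/
theorem key_bound (m : ℕ) :
    2 ^ ((m + 1) * (m + 1)) * (2 ^ m + 1) ≤
      2 ^ (m + 2) * ∏ i : Fin (m + 1), (2 ^ (m + 1) - 2 ^ (i : ℕ)) := by
  induction m with
  | zero => simp
  | succ m ih =>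
    rw [prod_two_pow_sub_succ (m + 1)]
    have hx1 : 1 ≤ 2 ^ m := Nat.one_le_two_pow
    have hy1 : 2 ^ (m + 1 + 1) - 1 + 1 = 4 * 2 ^ m := by
      rw [Nat.sub_add_cancel Nat.one_le_two_pow]
      ring
    have ih' : 2 ^ ((m + 1) * (m + 1)) * (2 ^ m + 1) ≤
        4 * 2 ^ m * ∏ i : Fin (m + 1), (2 ^ (m + 1) - 2 ^ (i : ℕ)) := by
      calc 2 ^ ((m + 1) * (m + 1)) * (2 ^ m + 1)
          ≤ 2 ^ (m + 2) * ∏ i : Fin (m + 1), (2 ^ (m + 1) - 2 ^ (i : ℕ)) := ih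
        _ = 4 * 2 ^ m * ∏ i : Fin (m + 1), (2 ^ (m + 1) - 2 ^ (i : ℕ)) := by ring
    calc 2 ^ ((m + 1 + 1) * (m + 1 + 1)) * (2 ^ (m + 1) + 1)
        = 2 ^ ((m + 1) * (m + 1)) * (8 * (2 ^ m * 2 ^ m)) * (2 * 2 ^ m + 1) := by ring
      _ ≤ 8 * 2 ^ m * ((2 ^ (m + 1 + 1) - 1) *
            (2 * 2 ^ m * ∏ i : Fin (m + 1), (2 ^ (m + 1) - 2 ^ (i : ℕ)))) :=
          step_arith hx1 hy1 ih'
      _ = 2 ^ (m + 1 + 2) * ((2 ^ (m + 1 + 1) - 1) *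
            (2 ^ (m + 1) * ∏ i : Fin (m + 1), (2 ^ (m + 1) - 2 ^ (i : ℕ)))) := by ring

/-- **stub_density** (P3): at least a quarter of all `n × n` matrices over `F₂` are invertible,
`4 · |GL_n(F₂)| ≥ 2^{n²}` (`|GL_n(F₂)| = ∏_{i<n} (2ⁿ - 2ⁱ)` by `Matrix.card_GL_field`, and
`key_bound`). [folklore] -/
theorem stub_density (n : ℕ) :
    2 ^ (n * n) ≤ 4 * Nat.card (Matrix.GeneralLinearGroup (Fin n) (ZMod 2)) := by
  rw [Matrix.card_GL_field, ZMod.card]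
  cases n with
  | zero => simp
  | succ m =>
    refine Nat.le_of_mul_le_mul_left ?_ (Nat.two_pow_pos m)
    calc 2 ^ m * 2 ^ ((m + 1) * (m + 1))
        ≤ 2 ^ ((m + 1) * (m + 1)) * (2 ^ m + 1) := by
          rw [mul_comm]
          exact Nat.mul_le_mul_left _ (Nat.le_succ _)
      _ ≤ 2 ^ (m + 2) * ∏ i : Fin (m + 1), (2 ^ (m + 1) - 2 ^ (i : ℕ)) := key_bound m
      _ = 2 ^ m * (4 * ∏ i : Fin (m + 1), (2 ^ (m + 1) - 2 ^ (i : ℕ))) := by ring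

end Summit.PneNP.PneNP.Cruxes.PeaThreeNotInP.TensorIsoLine

end
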